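import Mathlib.NumberTheory.PrimeCounting
import Mathlib.Analysis.SpecialFunctions.Pow.Real
import Literature.Computability.AlgebraicComplexity.ValiantBooleanBridge
import Literature.Computability.AlgebraicComplexity.ArithCircuitProofs
import Literature.Computability.Complexity.CircuitComposition
import Literature.Computability.Complexity.CircuitClassesProofs
import Literature.Computability.Complexity.CircuitClassesUniformProofs
import Literature.Computability.Complexity.PolyAdviceClosure
import Literature.Computability.Complexity.NondeterministicProofs
import HarnessLib

/-!
# Boolean parts of Valiant's classes (Bürgisser 2000): the decomposition of
`PPoly_eq_polyAdvice_NP_of_VP_eq_VNP`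

Trunk T-CPLX-ALG. This file decomposes the named fact
`Literature.PNP.PPoly_eq_polyAdvice_NP_of_VP_eq_VNP k` of `ValiantBooleanBridge.lean`
(Bürgisser, *Cook's versus Valiant's hypothesis*, TCS 235 (2000), Cor. 1.2(1): under GRH,
`VP_k = VNP_k` in characteristic zero gives `P/poly = NP/poly`) along the printed proof
(TCS 235, §5 and p. 79), into

* **(A2)** `NP_booleanPart_VNP k` — the counting function of an `NP` language is a *Boolean
  part* of a p-definable family (TCS §5 (A2), pp. 84–85: Cook's theorem plus arithmetisation of
  clauses; `#P ⊆ BP(VNP_k)`), stated for the tree's certificate definition of `NP`; no GRH, pure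
  algebra plus Cook–Levin; **proved here** (`NP_booleanPart_VNP_holds`, Part II below);
* **(A3)** `booleanPart_VP_cktSize k` — under GRH and in characteristic zero, a Boolean part of
  a p-computable family is computed by polynomial-size Boolean circuits (TCS Thm. 1.1(1),
  `BP(VP_k) ⊆ FNC³/poly`, weakened here to `FP/poly` = polynomial-size circuit families, p. 75);
  this is where all the number theory lives;
* **(Thm. 4.1)** `reduction_mod_primes_of_GRH` — Bürgisser's improvement of Koiran's theorem on
  reduction of solvable integer systems modulo many small primes under GRH (TCS Thm. 4.1,
  p. 79), the only place where GRH enters (A3); recorded for the future discharge of (A3);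

and PROVES the assembly: `NP ⊆ P/poly` from (A2), (A3), GRH and `VP_k = VNP_k`
(`NP_subset_PPoly_of_VP_eq_VNP`), `P/poly = NP/poly` from `NP ⊆ P/poly` and Arora–Barak's
Thm. 6.18 `PPoly = polyAdvice P` (`PPoly_eq_polyAdvice_NP_of_NP_subset_PPoly`), whence the
target fact from the three named facts (`PPoly_eq_polyAdvice_NP_of_VP_eq_VNP_of_facts`), and,
for the record, from `burgisser_collapse_of_VP_eq_VNP_charZero` (the interim proof,
`PPoly_eq_polyAdvice_NP_of_VP_eq_VNP_of_collapse`). With (A2) proved, the target fact follows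
from (A3) and Thm. 6.18 alone (`PPoly_eq_polyAdvice_NP_of_VP_eq_VNP_of_A3`, Part III).

## Part II: the proof of (A2) (arithmetisation of the verifier's circuits)

For `L ∈ NP = polyExists P` take a verifier `L' ∈ P` with certificate bound `p`. By
`P ⊆ P/poly` (`P_subset_PPoly_holds`) and `exists_cktSize_boolPair_of_mem_PPoly`, the maps
`(x, y) ↦ [⟨x, y⟩ ∈ L']` on `{0,1}ⁿ × {0,1}^m` have `B₂`-straight-line programs `gs n m` with
`s ≤ S(n)` gates for `m ≤ p(n)`, `S` polynomial. Introduce Boolean-sum variables `E_0, …, E_U`,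
`U = p(n) + S(n)`: `E_i`, `i < m`, for the certificate bits and `E_{p(n)+j}` for the value of
gate `j`. The *gate-consistency polynomial* of gate `j` is `EQ(E_{p(n)+j}, T_j)` with
`EQ(u, v) = uv + (1-u)(1-v)` and `T_j` the truth-table polynomial (sum over satisfying rows of
products of literals `w`, `1 - w`) of the gate in its argument wires; on Boolean points it is `1`
iff the gate equation holds (`eval_gateCheck`), and for an acyclic program all gate equations
hold iff the `E`'s are the true gate values (`gateEqs_iff_eq_vals`). Hence
`H_{n,m} = ∏_j EQ_j · (output wire) · ∏_{unused i} (1 - E_i)` is, at a Boolean point `(x, e)`,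
the indicator of "`e` is the consistent extension of its certificate `y` and `⟨x, y⟩ ∈ L'`"
(`eval_certCountPoly`), so `∑_e H_{n,m}(x, e) = #{y ∈ {0,1}^m | ⟨x, y⟩ ∈ L'}`
(`sum_eval_certCountPoly`), and `g_n = ∑_{m ≤ p(n)} H_{n,m}` is a p-computable p-family
(`isVPFamily_witnessPoly`: `L(g_n) ≤ (p(n)+1)(67 U + 6)`, `deg g_n ≤ 4U + 2`) whose Boolean sum
`f_n` (`countPoly`) satisfies `f_n(x) = #{y : |y| ≤ p(n), ⟨x, y⟩ ∈ L'} < 2^{p(n)+1}`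
(`eval_countPoly`), positive iff `x ∈ L`. This is Bürgisser's argument (TCS §5 (A2), pp. 84–85)
with the gates of the verifier's circuits arithmetised directly instead of the clauses of Cook's
3-CNF (each `EQ_j` is the arithmetisation of the `≤ 8` clauses describing one gate).

## The printed proof (TCS 235, restricted to `P/poly = NP/poly`)

p. 79: "Assume we had `VP_k = VNP_k`. For `char k = 0` we then obtain from Theorem 1.1 under
(GRH) that `#P/poly ⊆ BP(VNP_k) = BP(VP_k) ⊆ FNC³/poly ⊆ FP/poly ⊆ #P/poly`, thus we have
equality everywhere. In particular, `P/poly = NP/poly`." Here (Def. 2.1, p. 75) a *Boolean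
part* of a p-family `(f_n)`, `f_n ∈ k[X_1, …, X_n]`, is a string function `φ`,
`φ_n : {0,1}ⁿ → {0,1}^{m(n)}`, `m(n) = n^{O(1)}`, with `f_n(x) = ∑_i φ_{n,i}(x) 2^{i-1}` for all
`x ∈ {0,1}ⁿ` (`IsBooleanPart` below, with the number `φ_n(x) < 2^{t(n)}` in place of its bit
string), and `NP = {{x | φ(x) ≥ 1} | φ ∈ #P}` (p. 75).

## Design choices

* Families with a Boolean part have exactly `n` variables at level `n` (Def. 2.1), so they are
  typed `f : ∀ n, MvPolynomial (Fin n) k` and the classes are the predicates `IsVPFamily`,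
  `IsVNPFamily` of `ValiantClasses.lean`; the bundled family `⟨fun n => n, f⟩ : PolyFamily k` links
  them to the sets `VP k`, `VNP k` definitionally (`mem_VP_mk_iff`, `mem_VNP_mk_iff`).
* Boolean points of `kⁿ` are `boolPoint k x = fun i => if x i then 1 else 0`, the convention of
  `boolSum` in `ValiantClasses.lean`.
* "`φ ∈ FP/poly`" for the bit string of `φ_n(x)` is the multi-output circuit predicate `CktSize B2`
  of `CircuitComposition.lean` with a polynomial size bound (p. 75: "`FP/poly` is the class of
  string functions which can be computed by families of Boolean circuits of polynomial size").
* (A2) is stated for the tree's `NP = polyExists P` (certificates of length `≤ p |x|`) directly as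
  the existence of a p-definable family whose Boolean values count certificates; Bürgisser's
  `#P ⊆ BP(VNP_k)` composed with his definition of `NP` through `#P`.
* Thm. 4.1 is printed as `π_S(x) ≥ π(x)/d^{O(n)} - x^{1/2} log(wx)`; we state it with an
  existential exponent constant `c` and an existential absolute constant `C ≥ 0` in front of the
  error term (the printed form is `C = 1`), which is implied by the printed statement.
* GRH is the Dedekind (number-field) form `Literature.NumberTheory.LFunctions.ExtendedRiemannHypothesis`, as in
  `ValiantBooleanBridge.lean` (TCS p. 83: "(GRH) claims that all complex roots `s + it` of `ζ_K`
  in the critical strip satisfy `s = 1/2`").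
* Part II is written for an arbitrary commutative ring `k` (the counting identity holds with the
  count cast into `k`); the truth-table/equality polynomials and the lemma
  `gateEqs_iff_eq_vals` are generic in the gate basis and reusable for other arithmetisations.
* Mathlib has no Boolean parts, `P/poly`, or weights of integer polynomials (searched `weight`,
  `oneNorm`, `height`: `Mathlib.NumberTheory.Height` is the Weil height, unrelated); reused:
  `Nat.primeCounting`, `MvPolynomial.aeval`, `ZMod`, `Real.log`, `Real.sqrt`, `Real.rpow`.

## References

* P. Bürgisser, *Cook's versus Valiant's hypothesis*, Theoret. Comput. Sci. 235 (2000) 71–88: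
  Thm. 1.1 and Cor. 1.2 (pp. 73–74), Def. 2.1 (p. 75), Thm. 4.1 (p. 79), §5 (A2)–(A3)
  (pp. 84–86), proof of Cor. 1.2 (p. 79).
* P. Bürgisser, *Completeness and Reduction in Algebraic Complexity Theory*, Springer 2000,
  Ch. 4 (Thm. 4.5, Cor. 4.6: the book version).
* P. Koiran, *Hilbert's Nullstellensatz is in the polynomial hierarchy*, J. Complexity 12 (1996)
  273–286, Thm. 8 (the predecessor of Thm. 4.1).
* S. Arora, B. Barak, *Computational Complexity: A Modern Approach*, CUP 2009, Thm. 6.18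
  (`P/poly` = `P` with polynomial advice), Def. 6.16.
* R. M. Karp, R. J. Lipton, *Some connections between nonuniform and uniform complexity classes*,
  STOC 1980.
-/

noncomputable section

open MvPolynomial Literature.Computability.Complexity Literature.Computability.Complexity.Nondeterministic Literature.Computability.Complexity.Classes Literature.Computability.AlgebraicComplexity

namespace Literature.Computability.AlgebraicComplexity

universe u

/-! ### Boolean points and Boolean parts -/

section BooleanPoints

variable (k : Type u) [Zero k] [One k] {σ : Type*}

/-- The point of `kⁿ` with coordinates in `{0, 1}` coded by the bit vector `x`:
`boolPoint k x i = 1` if `x i = true` and `= 0` otherwise (Bürgisser 2000 TCS, Def. 2.1: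
"for all `x ∈ {0,1}ⁿ`"; the convention of `boolSum`). [cite: Burgisser2000TCS, Def. 2.1 p. 75] -/
def boolPoint (x : σ → Bool) : σ → k := fun i => if x i then 1 else 0

/-- Unfolding of `boolPoint`. [folklore] -/
@[simp] theorem boolPoint_apply (x : σ → Bool) (i : σ) :
    boolPoint k x i = if x i then (1 : k) else 0 := rfl

end BooleanPoints

section BooleanParts

variable (k : Type u) [CommSemiring k]

/-- `IsBooleanPart k f φ t`: the number function `φ` (with `φ n x < 2 ^ t n`, `t` p-bounded) is a
*Boolean part* of the family `f = (f_n)`, `f_n ∈ k[X_1, …, X_n]`: `f_n(x) = φ_n(x)` in `k` for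
every `x ∈ {0,1}ⁿ`. This is Bürgisser's Def. 2.1(1)(a) (characteristic zero) with the natural
number `φ_n(x) = ∑_{i=1}^{m(n)} φ_{n,i}(x) 2^{i-1}` in place of its bit string
`(φ_{n,1}(x), …, φ_{n,m(n)}(x))` and `t = m` (TCS 235, Def. 2.1, p. 75). The predicate is
defined over any commutative semiring (the cast `(φ n x : k)` then reads `φ_n(x) mod p` in
characteristic `p`), but in positive characteristic it is NOT Bürgisser's Def. 2.1(1)(b) (which
fixes `m = ⌊log p⌋ + 1` and coefficients in `𝔽_p`); it is used as Def. 2.1 only under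
`[CharZero k]` ((A3)). [cite: Burgisser2000TCS, Def. 2.1(1)(a) p. 75] -/
def IsBooleanPart (f : ∀ n, MvPolynomial (Fin n) k) (φ : ∀ n, (Fin n → Bool) → ℕ)
    (t : ℕ → ℕ) : Prop :=
  IsPBounded t ∧ (∀ n x, φ n x < 2 ^ t n) ∧ ∀ n x, eval (boolPoint k x) (f n) = φ n x

variable {k}

/-- The bit-size bound of a Boolean part is p-bounded (Def. 2.1: `m(n) = n^{O(1)}`). [cite: Burgisser2000TCS, Def. 2.1 p. 75] -/
theorem IsBooleanPart.isPBounded {f : ∀ n, MvPolynomial (Fin n) k}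
    {φ : ∀ n, (Fin n → Bool) → ℕ} {t : ℕ → ℕ} (h : IsBooleanPart k f φ t) : IsPBounded t :=
  h.1

/-- The values of a Boolean part are below `2 ^ t n`. [cite: Burgisser2000TCS, Def. 2.1 p. 75] -/
theorem IsBooleanPart.lt {f : ∀ n, MvPolynomial (Fin n) k}
    {φ : ∀ n, (Fin n → Bool) → ℕ} {t : ℕ → ℕ} (h : IsBooleanPart k f φ t) (n : ℕ)
    (x : Fin n → Bool) : φ n x < 2 ^ t n :=
  h.2.1 n x

/-- The defining identity of a Boolean part: `f_n(x) = φ_n(x)` on Boolean points. [cite: Burgisser2000TCS, Def. 2.1 p. 75] -/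
theorem IsBooleanPart.eval_eq {f : ∀ n, MvPolynomial (Fin n) k}
    {φ : ∀ n, (Fin n → Bool) → ℕ} {t : ℕ → ℕ} (h : IsBooleanPart k f φ t) (n : ℕ)
    (x : Fin n → Bool) : eval (boolPoint k x) (f n) = φ n x :=
  h.2.2 n x

/-- Families in exactly `n` variables bundle into `PolyFamily k` with `nvars = id`; membership in
`VP k` is then `IsVPFamily` by definition (Bürgisser 2000, Def. 2.4). [cite: Burgisser2000, Def. 2.4] -/
theorem mem_VP_mk_iff (f : ∀ n, MvPolynomial (Fin n) k) :
    (⟨fun n => n, f⟩ : PolyFamily k) ∈ VP k ↔ IsVPFamily f :=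
  Iff.rfl

/-- Likewise for `VNP k` and `IsVNPFamily` (Bürgisser 2000, Def. 2.5). [cite: Burgisser2000, Def. 2.5] -/
theorem mem_VNP_mk_iff (f : ∀ n, MvPolynomial (Fin n) k) :
    (⟨fun n => n, f⟩ : PolyFamily k) ∈ VNP k ↔ IsVNPFamily f :=
  Iff.rfl

/-- If `VP k = VNP k` then every p-definable family in `n` variables is p-computable
(definitional bookkeeping behind "`BP(VNP_k) = BP(VP_k)`", TCS p. 79). [cite: Burgisser2000TCS, p. 79 proof of Cor. 1.2] -/
theorem isVPFamily_of_VP_eq_VNP (h : VP k = VNP k) {f : ∀ n, MvPolynomial (Fin n) k}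
    (hf : IsVNPFamily f) : IsVPFamily f := by
  rw [← mem_VP_mk_iff, h]
  exact hf

end BooleanParts

/-! ### The named facts (A2), (A3) and Theorem 4.1 -/

section Facts

variable (k : Type u) [Field k]

/-- **(A2)** (Bürgisser 2000 TCS, §5 (A2), pp. 84–85, proving the inclusion `#P/poly ⊆ BP(VNP_k)`
of Thm. 1.1; here its uniform part `#P ⊆ BP(VNP_k)` composed with `NP = {{x | φ(x) ≥ 1} | φ ∈ #P}`,
p. 75, and stated for the tree's certificate definition `NP = polyExists P`): for every
`L ∈ NP` there is a p-definable family `f = (f_n)`, `f_n ∈ k[X_1, …, X_n]`, with a Boolean part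
`φ` such that `x ∈ L ↔ φ_n(x) ≥ 1` for all `x ∈ {0,1}ⁿ`. Printed proof: by Cook's theorem the
number of accepting certificates is `#{y | φ_n(x, y)}` for 3-CNFs `φ_n`; with clause polynomials
`g_K` of degree `≤ 3`, `f_n = ∏_K g_K` is p-computable and `g_n = ∑_{y ∈ {0,1}^m} f_n(X, y)` is
p-definable with `g_n(x) = φ(x)`. No GRH and no hypothesis on the characteristic are needed for
this direction (in characteristic `p` the identity holds with `φ(x) mod p`, which is what the
cast `(φ n x : k)` says). Discharged below (`NP_booleanPart_VNP_holds`, Part II) by arithmetising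
the `B₂`-programs of the verifier; users are fed `NP_booleanPart_VNP_holds k`. [cite: Burgisser2000TCS, §5 (A2) pp. 84–85 and Thm. 1.1(1) p. 73] -/
def NP_booleanPart_VNP : Prop :=
  ∀ L ∈ NP, ∃ (f : ∀ n, MvPolynomial (Fin n) k) (φ : ∀ n, (Fin n → Bool) → ℕ) (t : ℕ → ℕ),
    IsVNPFamily f ∧ IsBooleanPart k f φ t ∧ ∀ n (x : Fin n → Bool), List.ofFn x ∈ L ↔ 0 < φ n x

/-- **(A3)** (Bürgisser 2000 TCS, Thm. 1.1(1), p. 73: "Under (GRH) we have for fields `k` of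
characteristic zero `FNC¹/poly ⊆ BP(VP_k) ⊆ FNC³/poly`", second inclusion, proved in §5 (A3),
pp. 85–86), weakened from `FNC³/poly` to `FP/poly`, the string functions computed by
polynomial-size circuit families (p. 75): assuming the (Dedekind) generalised Riemann hypothesis,
if `φ` is a Boolean part (bit size `t`) of a p-computable family `f` over a field of
characteristic zero, then the bit strings `(bit_i φ_n(x))_{i < t(n)}` are computed by
`B₂`-straight-line programs of size `q(n)` for some polynomial `q`. The printed proof replaces the
constants of the circuits by indeterminates, transfers solvability of the resulting integer
system from `k` to `ℂ` (Nullstellensatz), reduces modulo a prime `p_n` of polynomial bit-size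
with `p_n > 2^{t(n)}` supplied by Thm. 4.1 (`reduction_mod_primes_of_GRH`, the only use of GRH),
and simulates the circuit over `𝔽_{p_n}` by Boolean circuits. Book version: Bürgisser 2000,
Thm. 4.5. [cite: Burgisser2000TCS, Thm. 1.1(1) p. 73 and §5 (A3) pp. 85–86] [cite: Burgisser2000, Thm. 4.5] -/
def booleanPart_VP_cktSize : Prop :=
  ∀ [CharZero k], Literature.NumberTheory.LFunctions.ExtendedRiemannHypothesis → ∀ (f : ∀ n, MvPolynomial (Fin n) k)
    (φ : ∀ n, (Fin n → Bool) → ℕ) (t : ℕ → ℕ),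
    IsVPFamily f → IsBooleanPart k f φ t →
      ∃ q : Polynomial ℕ, ∀ n,
        CktSize B2 (fun (x : Fin n → Bool) (i : Fin (t n)) => (φ n x).testBit i) (q.eval n)

end Facts

section ReductionModPrimes

/-- The *weight* `wt(f)` of an integer polynomial: the sum of the absolute values of its
coefficients (Bürgisser 2000 TCS, p. 76: "We define the weight `wt(f)` of a polynomial
`f ∈ ℤ[X_1, …, X_n]` as the sum of the absolute values of its coefficients"). [cite: Burgisser2000TCS, p. 76] -/
def weight {σ : Type*} (f : MvPolynomial σ ℤ) : ℕ :=
  f.support.sum fun m => (f.coeff m).natAbs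

/-- The weight of the zero polynomial is `0`. [folklore] -/
@[simp] theorem weight_zero {σ : Type*} : weight (0 : MvPolynomial σ ℤ) = 0 := by
  simp [weight]

/-- `π_S(x)`: the number of primes `p ≤ x` such that the integer system `S = (f_1, …, f_s)`,
`f_i ∈ ℤ[X_1, …, X_n]`, has a common zero in the prime field `𝔽_p = ZMod p`
(Bürgisser 2000 TCS, p. 79). [cite: Burgisser2000TCS, §4 p. 79] -/
def solvableModPrimeCount {n s : ℕ} (S : Fin s → MvPolynomial (Fin n) ℤ) (x : ℕ) : ℕ := by
  classical
  exact ((Finset.range (x + 1)).filter fun p =>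
    p.Prime ∧ ∃ z : Fin n → ZMod p, ∀ i, aeval z (S i) = 0).card

/-- `π_S(x) ≤ π(x)`: only primes are counted. [folklore] -/
theorem solvableModPrimeCount_le_primeCounting {n s : ℕ} (S : Fin s → MvPolynomial (Fin n) ℤ)
    (x : ℕ) : solvableModPrimeCount S x ≤ Nat.primeCounting x := by
  classical
  rw [solvableModPrimeCount, Nat.primeCounting, Nat.primeCounting', Nat.count_eq_card_filter_range]
  exact Finset.card_le_card (Finset.monotone_filter_right _ fun p _ hp => hp.1)

/-- **Reduction modulo primes under GRH** (Bürgisser 2000 TCS, Thm. 4.1, p. 79, improving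
Koiran 1996, Thm. 8): "Let `f_1, …, f_s ∈ ℤ[X_1, …, X_n]` be polynomials of degree and weight
bounded by `d ≥ n` and `w`, respectively. […] Assuming (GRH), we have
`π_S(x) ≥ π(x)/d^{O(n)} - x^{1/2} log(wx)` for all systems (S) solvable over `ℂ`", where `π_S(x)`
counts the primes `p ≤ x` with (S) solvable over `𝔽_p`. Stated with an existential exponent
constant `c > 0` (the `O(n)`) and an absolute constant `C ≥ 0` in front of the error term
(printed: `C = 1`; the present form is implied by the printed one), uniformly in `n, s, d, w` and
the system, and under the side condition `n < d` (the relation symbol between `d` and `n` in the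
printed hypothesis "bounded by `d ≥ n`" is typographically ambiguous between `≥` and `>` in our
copy; we assume the stronger hypothesis `n < d`, under which the statement is implied by either
reading, and which costs nothing in applications since `d` is only an upper bound). (GRH) is the Riemann hypothesis for the Dedekind zeta functions of number fields
(p. 83), i.e. `Literature.NumberTheory.LFunctions.ExtendedRiemannHypothesis`. The proof (§4) combines a geometric resolution with
height bounds (Thm. 4.5, after Krick–Pardo), reduction of an algebraic solution modulo primes
with a root of the minimal polynomial (Rem. 4.6), and the effective prime ideal theorem under GRH
(Weinberger; Lagarias–Odlyzko; Thm. 4.7, Cor. 4.8). [cite: Burgisser2000TCS, Thm. 4.1 p. 79] [cite: Koiran1996, Thm. 8] -/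
def reduction_mod_primes_of_GRH : Prop :=
  Literature.NumberTheory.LFunctions.ExtendedRiemannHypothesis →
    ∃ c C : ℝ, 0 < c ∧ 0 ≤ C ∧
      ∀ (n s d w : ℕ) (S : Fin s → MvPolynomial (Fin n) ℤ),
        n < d → (∀ i, (S i).totalDegree ≤ d) → (∀ i, weight (S i) ≤ w) →
        (∃ z : Fin n → ℂ, ∀ i, aeval z (S i) = 0) →
        ∀ x : ℕ, (Nat.primeCounting x : ℝ) / (d : ℝ) ^ (c * n) - C * Real.sqrt x * Real.log (w * x)
          ≤ (solvableModPrimeCount S x : ℝ)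

end ReductionModPrimes

/-! ### From circuits for the bits to `P/poly` membership of the positivity language -/

section Positivity

/-- The disjunction of `T` input bits has a `B₂`-straight-line program with `T + 1` gates
(a chain of binary `∨` gates after one constant; Vollmer 1999, §1.1). [folklore] -/
theorem cktSize_exists_fin : ∀ T : ℕ,
    CktSize B2 (fun (b : Fin T → Bool) (_ : Unit) => decide (∃ i, b i = true)) (T + 1)
  | 0 => ((cktSize_const (Fin 0) false).of_le (by omega)).congr fun b _ => by simp
  | T + 1 => by
    have ih := cktSize_exists_fin T
    -- the disjunction of the first `T` bits, rewired to the inputs `Fin (T + 1)`, paired with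
    -- the last input bit
    have h1 : CktSize B2 (fun (b : Fin (T + 1) → Bool) =>
        Sum.elim (fun (_ : Unit) => decide (∃ i : Fin T, b (Fin.castSucc i) = true))
          (fun (_ : Unit) => b (Fin.last T))) ((T + 1) + 0) :=
      ((ih.rewire Fin.castSucc).congr fun b _ => rfl).pair
        ((CktSize.proj B2 fun (_ : Unit) => Fin.last T).congr fun b _ => rfl)
    have h2 := h1.comp (cktSize_or (ι := Unit ⊕ Unit) (Sum.inl ()) (Sum.inr ()))
    refine (h2.of_le (by omega)).congr fun b _ => ?_
    simp only [Sum.elim_inl, Sum.elim_inr]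
    cases hlast : b (Fin.last T) <;> simp [hlast, Fin.exists_fin_succ']

/-- A natural number below `2 ^ t` is positive iff one of its bits `i < t` is set. [folklore] -/
theorem pos_iff_exists_testBit {N t : ℕ} (hN : N < 2 ^ t) :
    0 < N ↔ ∃ i : Fin t, N.testBit i = true := by
  constructor
  · intro hpos
    obtain ⟨i, hi, -⟩ := Nat.exists_most_significant_bit hpos.ne'
    refine ⟨⟨i, lt_of_not_ge fun hle => ?_⟩, hi⟩
    rw [Nat.testBit_eq_false_of_lt
      (lt_of_lt_of_le hN (Nat.pow_le_pow_right Nat.two_pos hle))] at hi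
    exact Bool.false_ne_true hi
  · rintro ⟨i, hi⟩
    rcases Nat.eq_zero_or_pos N with rfl | hpos
    · rw [Nat.zero_testBit] at hi
      exact absurd hi Bool.false_ne_true
    · exact hpos

/-- If the bit strings of a number function `φ` with `φ n x < 2 ^ t n`, `t` p-bounded, are
computed by `B₂`-programs of polynomial size, then the positivity language
`{w | φ_{|w|}(w) ≥ 1}` is in `P/poly`: append a disjunction of the `t n` output bits
(`cktSize_exists_fin`) and pass to single-output circuits (`CktSize.toCircuit`)
(Arora–Barak 2009, Def. 6.5; the step "switching to the corresponding classes of languages" of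
Bürgisser 2000 TCS, p. 79). [cite: Burgisser2000TCS, p. 79 proof of Cor. 1.2] -/
theorem positivity_mem_PPoly {φ : ∀ n, (Fin n → Bool) → ℕ} {t : ℕ → ℕ} (ht : IsPBounded t)
    (hφ : ∀ n x, φ n x < 2 ^ t n) {q : Polynomial ℕ}
    (hq : ∀ n, CktSize B2 (fun (x : Fin n → Bool) (i : Fin (t n)) => (φ n x).testBit i)
      (q.eval n)) :
    {w : List Bool | 0 < φ w.length w.get} ∈ PPoly := by
  obtain ⟨r, hr⟩ := (isPBounded_iff_exists_polynomial_holds t).1 ht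
  have main : ∀ n : ℕ, ∃ D : Circuit (Fin n), D.IsOver B2 ∧ D.size ≤ (q + r + 1).eval n ∧
      ∀ x : Fin n → Bool, D.eval x = decide (0 < φ n x) := by
    intro n
    have h := ((hq n).comp (cktSize_exists_fin (t n))).congr (g := fun x (_ : Unit) =>
      decide (0 < φ n x)) fun x _ => by
        simp only
        rw [Bool.decide_congr (pos_iff_exists_testBit (hφ n x))]
    obtain ⟨D, hDB, hDs, hDe⟩ := h.toCircuit
    refine ⟨D, hDB, hDs.trans ?_, hDe⟩
    have := hr n
    simp only [Polynomial.eval_add, Polynomial.eval_one]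
    omega
  choose D hD using main
  refine Set.mem_iUnion.2 ⟨q + r + 1, D, fun n => ⟨(hD n).1, (hD n).2.1⟩, fun w => ?_⟩
  rw [(hD w.length).2.2 w.get]
  by_cases hw : 0 < φ w.length w.get
  · rw [decide_eq_true hw, eq_comm, ← Set.mem_iff_boolIndicator]
    exact hw
  · rw [decide_eq_false hw, eq_comm, ← Set.notMem_iff_boolIndicator]
    exact hw

end Positivity

/-! ### Assembly -/

section Assembly

variable {k : Type u} [Field k]

/-- **`NP ⊆ P/poly` from `VP_k = VNP_k`, GRH and characteristic zero**, assembled from (A2) and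
(A3) exactly as on p. 79 of Bürgisser 2000 TCS: for `L ∈ NP` take the p-definable family `f`
with Boolean part `φ` counting certificates (A2); `VP_k = VNP_k` makes `f` p-computable; (A3)
computes the bits of `φ` by polynomial-size circuits; a disjunction of the bits decides `L`
(`positivity_mem_PPoly`). [cite: Burgisser2000TCS, Cor. 1.2(1) p. 74 and its proof p. 79] -/
theorem NP_subset_PPoly_of_VP_eq_VNP (hA2 : NP_booleanPart_VNP k)
    (hA3 : booleanPart_VP_cktSize k) [CharZero k] (hGRH : Literature.NumberTheory.LFunctions.ExtendedRiemannHypothesis)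
    (h : VP k = VNP k) : NP ⊆ PPoly := by
  intro L hL
  obtain ⟨f, φ, t, hf, hφ, hLφ⟩ := hA2 L hL
  obtain ⟨q, hq⟩ := hA3 hGRH f φ t (isVPFamily_of_VP_eq_VNP h hf) hφ
  have hmem := positivity_mem_PPoly hφ.isPBounded hφ.lt hq
  have hEq : L = {w : List Bool | 0 < φ w.length w.get} := by
    ext w
    have := hLφ w.length w.get
    rw [List.ofFn_get] at this
    exact this
  rw [hEq]
  exact hmem

/-- **`P/poly = NP/poly` from `NP ⊆ P/poly`** (Karp–Lipton bookkeeping; Bürgisser 2000 TCS, p. 79: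
"In particular, `P/poly = NP/poly`"): `PPoly = polyAdvice P ⊆ polyAdvice NP` by Arora–Barak's
Thm. 6.18 (the named fact `PPoly_eq_polyAdvice_P`) and `P ⊆ NP` (`P_subset_NP_holds`); conversely
`polyAdvice NP ⊆ polyAdvice PPoly ⊆ PPoly` (`polyAdvice_subset_PPoly`, advice is hard-wired).
[cite: Burgisser2000TCS, p. 79 proof of Cor. 1.2] [cite: AroraBarak2009, Thm. 6.18] -/
theorem PPoly_eq_polyAdvice_NP_of_NP_subset_PPoly (h618 : PPoly_eq_polyAdvice_P)
    (hNP : NP ⊆ PPoly) : PPoly = polyAdvice NP := by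
  refine Set.Subset.antisymm ?_ (polyAdvice_subset_PPoly hNP)
  calc PPoly = polyAdvice P := h618
    _ ⊆ polyAdvice NP := polyAdvice_mono P_subset_NP_holds

/-- `P/poly-advice = NP/poly` from `NP ⊆ P/poly` (the first conjunct of
`burgisser_collapse_of_VP_eq_VNP_charZero` in this situation): `polyAdvice P ⊆ polyAdvice NP` by
monotonicity and `P ⊆ NP`, and `polyAdvice NP ⊆ PPoly = polyAdvice P` (Arora–Barak 2009,
Thm. 6.18; Karp–Lipton 1980). [cite: AroraBarak2009, Thm. 6.18] -/
theorem polyAdvice_P_eq_polyAdvice_NP_of_NP_subset_PPoly (h618 : PPoly_eq_polyAdvice_P)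
    (hNP : NP ⊆ PPoly) : polyAdvice P = polyAdvice NP := by
  refine Set.Subset.antisymm (polyAdvice_mono P_subset_NP_holds) ?_
  calc polyAdvice NP ⊆ PPoly := polyAdvice_subset_PPoly hNP
    _ = polyAdvice P := h618

/-- **The target fact from the decomposition**: `PPoly_eq_polyAdvice_NP_of_VP_eq_VNP k`
(Bürgisser 2000 TCS, Cor. 1.2(1); book Cor. 4.6(1)) follows from (A2) `NP_booleanPart_VNP k`,
(A3) `booleanPart_VP_cktSize k` and Arora–Barak's Thm. 6.18 `PPoly_eq_polyAdvice_P`.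
[cite: Burgisser2000TCS, Cor. 1.2(1) p. 74] [cite: Burgisser2000, Cor. 4.6(1)] -/
theorem PPoly_eq_polyAdvice_NP_of_VP_eq_VNP_of_facts (h618 : PPoly_eq_polyAdvice_P)
    (hA2 : NP_booleanPart_VNP k) (hA3 : booleanPart_VP_cktSize k) :
    PPoly_eq_polyAdvice_NP_of_VP_eq_VNP k := by
  intro _ hGRH h
  exact PPoly_eq_polyAdvice_NP_of_NP_subset_PPoly h618
    (NP_subset_PPoly_of_VP_eq_VNP hA2 hA3 hGRH h)

/-- The first conjunct `polyAdvice P = polyAdvice NP` of `burgisser_collapse_of_VP_eq_VNP_charZero k`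
from the same decomposition (Bürgisser 2000 TCS, Cor. 1.2(1)). [cite: Burgisser2000TCS, Cor. 1.2(1) p. 74] -/
theorem polyAdvice_P_eq_polyAdvice_NP_of_VP_eq_VNP_of_facts (h618 : PPoly_eq_polyAdvice_P)
    (hA2 : NP_booleanPart_VNP k) (hA3 : booleanPart_VP_cktSize k) [CharZero k]
    (hGRH : Literature.NumberTheory.LFunctions.ExtendedRiemannHypothesis) (h : VP k = VNP k) : polyAdvice P = polyAdvice NP :=
  polyAdvice_P_eq_polyAdvice_NP_of_NP_subset_PPoly h618
    (NP_subset_PPoly_of_VP_eq_VNP hA2 hA3 hGRH h)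

/-- The interim derivation, restored as a theorem: the target fact is a corollary of **pnp.S26**
`burgisser_collapse_of_VP_eq_VNP_charZero k` and Arora–Barak's Thm. 6.18
`PPoly_eq_polyAdvice_P` (Bürgisser 2000, Cor. 4.6(1); TCS Cor. 1.2(1)). [cite: Burgisser2000TCS, Cor. 1.2(1) p. 74] [cite: Burgisser2000, Cor. 4.6(1)] -/
theorem PPoly_eq_polyAdvice_NP_of_VP_eq_VNP_of_collapse (h618 : PPoly_eq_polyAdvice_P)
    (hB : burgisser_collapse_of_VP_eq_VNP_charZero k) :
    PPoly_eq_polyAdvice_NP_of_VP_eq_VNP k := by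
  intro _ hGRH h
  rw [h618]
  exact (hB hGRH h).1

end Assembly

/-! ## Part II: proof of (A2) — counting certificates is a Boolean part of a p-definable family -/

open scoped Classical
open Complexity.GateList

/-! ### Values of well-formed gate lists -/

section GateLists

variable {ι : Type*}

/-- In a well-formed program, the recorded value of gate `j` is its truth table applied to the
values of its argument wires (read off the full value list). [folklore] -/
theorem wireOf_vals_inr {gs : List (Gate ι)} (hwf : WF gs) (x : ι → Bool) (j : ℕ)
    (hj : j < gs.length) :
    wireOf x (vals gs x) (.inr j) = (gs[j]).op fun a => wireOf x (vals gs x) ((gs[j]).args a) := by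
  induction gs using List.reverseRecOn generalizing j with
  | nil => simp at hj
  | append_singleton gs g ih =>
    have hwf' : WF gs := hwf.of_append_left
    rw [vals_append_singleton]
    rcases Nat.lt_or_ge j gs.length with hlt | hge
    · -- an old gate
      rw [List.getElem_append_left hlt, wireOf_append_of_lt _ _ _ _ (fun m hm => by
        rw [length_vals]; cases hm; exact hlt), ih hwf' j hlt]
      exact congrArg _ (funext fun a => (wireOf_append_of_lt _ _ _ _ fun m hm => by
        rw [length_vals]
        exact (hwf' j _ (List.getElem?_eq_getElem hlt) _ m hm).trans hlt).symm)
    · -- the new gate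
      have hj' : j = gs.length := by
        rw [List.length_append, List.length_singleton] at hj; omega
      subst hj'
      have hget : (gs ++ [g])[gs.length]'hj = g := by simp
      rw [hget]
      rw [wireOf_inr, List.getD_eq_getElem?_getD, List.getElem?_append_right (by rw [length_vals]),
        length_vals, Nat.sub_self, List.getElem?_cons_zero, Option.getD_some]
      exact congrArg _ (funext fun a => (wireOf_append_of_lt _ _ _ _ fun m hm => by
        rw [length_vals]; exact hwf.getLast a m hm).symm)

/-- **Local consistency is global correctness** for well-formed (acyclic) programs: an
assignment `v` of bits to the gate positions satisfies every gate equation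
`v j = op_j (arguments read off x and v)` (wires read by `Sum.elim x v`) iff it is the true value
list `vals gs x` (the principle behind Cook's theorem; Arora–Barak 2009, Lem. 6.10 / Thm. 2.10). [folklore] -/
theorem gateEqs_iff_eq_vals {gs : List (Gate ι)} (hwf : WF gs) (x : ι → Bool) (v : ℕ → Bool) :
    (∀ j (hj : j < gs.length), v j = (gs[j]).op fun a => Sum.elim x v ((gs[j]).args a)) ↔
      ∀ j, j < gs.length → v j = wireOf x (vals gs x) (.inr j) := by
  constructor
  · intro h j
    induction j using Nat.strong_induction_on with
    | _ j ih =>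
      intro hj
      rw [h j hj, wireOf_vals_inr hwf x j hj]
      refine congrArg _ (funext fun a => ?_)
      rcases hw : (gs[j]).args a with i | m
      · rfl
      · have hm : m < j := hwf j _ (List.getElem?_eq_getElem hj) a m hw
        exact ih m hm (hm.trans hj)
  · intro h j hj
    rw [h j hj, wireOf_vals_inr hwf x j hj]
    refine congrArg _ (funext fun a => ?_)
    rcases hw : (gs[j]).args a with i | m
    · rfl
    · have hm : m < j := hwf j _ (List.getElem?_eq_getElem hj) a m hw
      exact (h m (hm.trans hj)).symm

end GateLists

/-! ### Arithmetisation of truth tables and gate equations -/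

section Arith

variable {k : Type u} [CommRing k] {τ : Type*}

/-- The field element `[b] ∈ {0, 1}` of a bit (`boolPoint k x i = bitVal (x i)`). [folklore] -/
def bitVal (b : Bool) : k := if b then 1 else 0

/-- `[1] = 1`. [folklore] -/
@[simp] theorem bitVal_true : (bitVal true : k) = 1 := rfl

/-- `[0] = 0`. [folklore] -/
@[simp] theorem bitVal_false : (bitVal false : k) = 0 := rfl

/-- `boolPoint` is `bitVal` coordinatewise (definitional). [folklore] -/
theorem boolPoint_apply_eq_bitVal {σ : Type*} (x : σ → Bool) (i : σ) :
    boolPoint k x i = bitVal (x i) := rfl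

/-- The *literal polynomial*: `u` for a positive literal, `1 - u` for a negative one (the factors
of Bürgisser's clause polynomials, TCS §5 (A2), p. 85: "for `K = u ∨ v ∨ w` take
`g_K := uvw + uv(1 − w) + u(1 − v)w + (1 − u)vw + u(1 − v)(1 − w) + (1 − u)v(1 − w) + (1 − u)(1 − v)w`").
[cite: Burgisser2000TCS, §5 (A2) p. 85] -/
def litPoly (b : Bool) (u : MvPolynomial τ k) : MvPolynomial τ k := if b then u else 1 - u

/-- On a Boolean value `[c]` the literal polynomial of sign `b` evaluates to `[b = c]`. [folklore] -/
theorem eval_litPoly (pt : τ → k) (b c : Bool) (u : MvPolynomial τ k) (hu : eval pt u = bitVal c) :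
    eval pt (litPoly b u) = if b = c then 1 else 0 := by
  cases b <;> cases c <;> simp [litPoly, hu]

/-- The *truth-table polynomial* of `op : {0,1}^a → {0,1}` in the argument polynomials `w`:
`∑_{b : op b = 1} ∏_t lit_{b_t}(w_t)`, the sum over the satisfying rows of the products of
literals. This is Bürgisser's clause polynomial `g_K` (TCS §5 (A2), pp. 84–85: "for each
3-clause `K` there is a polynomial `g_K` in three variables of degree `≤ 3` and with coefficients
of size `O(1)`" taking the truth value of `K` on `{0,1}³`), for an arbitrary truth table of small
arity in place of a 3-clause. [cite: Burgisser2000TCS, §5 (A2) pp. 84–85] -/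
def tablePoly {a : ℕ} (op : (Fin a → Bool) → Bool) (w : Fin a → MvPolynomial τ k) :
    MvPolynomial τ k :=
  ∑ b ∈ Finset.univ.filter (fun b => op b = true), ∏ t, litPoly (b t) (w t)

/-- On Boolean arguments `[c_t]` the truth-table polynomial evaluates to `[op c]`. [folklore] -/
theorem eval_tablePoly (pt : τ → k) {a : ℕ} (op : (Fin a → Bool) → Bool)
    (w : Fin a → MvPolynomial τ k) (c : Fin a → Bool) (hw : ∀ t, eval pt (w t) = bitVal (c t)) :
    eval pt (tablePoly op w) = bitVal (op c) := by
  simp only [tablePoly, map_sum, map_prod]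
  have hb : ∀ b : Fin a → Bool,
      (∏ t, eval pt (litPoly (b t) (w t))) = if b = c then (1 : k) else 0 := by
    intro b
    rw [Finset.prod_congr rfl fun t _ => eval_litPoly pt (b t) (c t) (w t) (hw t),
      Finset.prod_boole]
    simp [funext_iff]
  simp only [hb, Finset.sum_ite_eq', Finset.mem_filter, Finset.mem_univ, true_and]
  cases op c <;> simp

/-- The *equality polynomial* `u v + (1 - u)(1 - v)`: on Boolean values `[a], [b]` it
evaluates to `[a = b]`. [folklore] -/
def eqPoly (u v : MvPolynomial τ k) : MvPolynomial τ k := u * v + (1 - u) * (1 - v)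

/-- Evaluation of the equality polynomial on Boolean values. [folklore] -/
theorem eval_eqPoly (pt : τ → k) {u v : MvPolynomial τ k} {a b : Bool} (hu : eval pt u = bitVal a)
    (hv : eval pt v = bitVal b) : eval pt (eqPoly u v) = if a = b then 1 else 0 := by
  cases a <;> cases b <;> simp [eqPoly, hu, hv]

variable {ι : Type*}

/-- The variable standing for a wire: input wires `inl i` are sent to the variable `inV i`,
gate wires `inr m` to the variable `gV m` ("introduce a new variable for every gate", Cook's
theorem; Bürgisser 2000 TCS, §5 (A2)). [cite: Burgisser2000TCS, §5 (A2) p. 84] -/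
def wirePoly (inV : ι → τ) (gV : ℕ → τ) : ι ⊕ ℕ → MvPolynomial τ k
  | .inl i => X (inV i)
  | .inr m => X (gV m)

/-- At a Boolean point `z`, the wire variable carries the bit read off `z`. [folklore] -/
theorem eval_wirePoly (z : τ → Bool) (inV : ι → τ) (gV : ℕ → τ) (w : ι ⊕ ℕ) :
    eval (boolPoint k z) (wirePoly inV gV w) = bitVal (Sum.elim (z ∘ inV) (z ∘ gV) w) := by
  cases w <;> simp [wirePoly, bitVal]

/-- The *gate-consistency polynomial* of gate `g` at position `j`: `EQ(Z_j, T_g(wires))`, equal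
to `1` at a Boolean point iff the bit assigned to gate `j` is `op_g` of the bits of its argument
wires (the arithmetised clauses of Cook's 3-CNF for one gate; Bürgisser 2000 TCS, §5 (A2)). [cite: Burgisser2000TCS, §5 (A2) pp. 84–85] -/
def gateCheck (inV : ι → τ) (gV : ℕ → τ) (j : ℕ) (g : Gate ι) : MvPolynomial τ k :=
  eqPoly (X (gV j)) (tablePoly g.op fun a => wirePoly inV gV (g.args a))

/-- Evaluation of the gate-consistency polynomial at a Boolean point. [folklore] -/
theorem eval_gateCheck (z : τ → Bool) (inV : ι → τ) (gV : ℕ → τ) (j : ℕ) (g : Gate ι) :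
    eval (boolPoint k z) (gateCheck inV gV j g) =
      if z (gV j) = g.op (fun a => Sum.elim (z ∘ inV) (z ∘ gV) (g.args a)) then 1 else 0 :=
  eval_eqPoly _ (by simp [bitVal])
    (eval_tablePoly _ g.op _ _ fun a => eval_wirePoly z inV gV (g.args a))

/-- The product of the gate-consistency polynomials of a program (`f_n = ∏_K g_K` in
Bürgisser 2000 TCS, §5 (A2), p. 84). [cite: Burgisser2000TCS, §5 (A2) p. 84] -/
def checksPoly (inV : ι → τ) (gV : ℕ → τ) (gs : List (Gate ι)) : MvPolynomial τ k :=
  ∏ j : Fin gs.length, gateCheck inV gV j gs[j]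

/-- **Correctness of the arithmetisation.** At a Boolean point `z`, the product of the
gate-consistency polynomials of a well-formed program is `1` if the bits `z (gV j)` are the true
gate values of the program on the input bits `z ∘ inV`, and `0` otherwise. [cite: Burgisser2000TCS, §5 (A2) pp. 84–85] -/
theorem eval_checksPoly {gs : List (Gate ι)} (hwf : WF gs) (z : τ → Bool) (inV : ι → τ)
    (gV : ℕ → τ) :
    eval (boolPoint k z) (checksPoly inV gV gs) =
      if ∀ j, j < gs.length → z (gV j) = wireOf (z ∘ inV) (vals gs (z ∘ inV)) (.inr j)
      then 1 else 0 := by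
  rw [checksPoly, map_prod]
  simp only [eval_gateCheck, Finset.prod_boole, Finset.mem_univ, true_implies]
  refine if_congr (Iff.trans ?_ (gateEqs_iff_eq_vals hwf (z ∘ inV) (z ∘ gV))) rfl rfl
  rw [Fin.forall_iff]
  rfl

/-! ### Size and degree of the arithmetisation -/

/-- `L(1 - f) ≤ L(f) + 2` (write `1 - f = 1 + (-1) • f`). [folklore] -/
theorem complexity_one_sub_le (f : MvPolynomial τ k) : complexity (1 - f) ≤ complexity f + 2 := by
  have h : (1 : MvPolynomial τ k) - f = C 1 + (-1 : k) • f := by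
    rw [neg_one_smul, C_1, sub_eq_add_neg]
  rw [h]
  calc complexity (C 1 + (-1 : k) • f) ≤ complexity (C (1 : k) : MvPolynomial τ k) +
      complexity ((-1 : k) • f) + 1 := complexity_add_le_holds _ _
    _ ≤ 0 + (complexity f + 1) + 1 := by
      gcongr
      · exact (complexity_C_holds (σ := τ) (1 : k)).le
      · exact complexity_smul_le_holds _ _
    _ = complexity f + 2 := by ring

/-- `L(lit_b(u)) ≤ L(u) + 2`. [folklore] -/
theorem complexity_litPoly_le (b : Bool) (u : MvPolynomial τ k) :
    complexity (litPoly b u) ≤ complexity u + 2 := by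
  cases b
  · exact complexity_one_sub_le u
  · exact Nat.le_add_right _ _

/-- Size of a truth-table polynomial: `≤ 2^a ((c + 3) a + 1)` if the arguments have size
`≤ c`. [folklore] -/
theorem complexity_tablePoly_le {a : ℕ} (op : (Fin a → Bool) → Bool) (w : Fin a → MvPolynomial τ k)
    {c : ℕ} (hw : ∀ t, complexity (w t) ≤ c) :
    complexity (tablePoly op w) ≤ 2 ^ a * ((c + 3) * a + 1) := by
  unfold tablePoly
  set s := Finset.univ.filter (fun b : Fin a → Bool => op b = true)
  have hs : s.card ≤ 2 ^ a := by
    calc s.card ≤ (Finset.univ : Finset (Fin a → Bool)).card := Finset.card_filter_le _ _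
      _ = 2 ^ a := by simp
  have hprod : ∀ b ∈ s, complexity (∏ t, litPoly (b t) (w t)) ≤ (c + 3) * a := by
    intro b _
    calc complexity (∏ t, litPoly (b t) (w t))
        ≤ ∑ t, complexity (litPoly (b t) (w t)) + (Finset.univ : Finset (Fin a)).card :=
          complexity_finset_prod_le _ _
      _ ≤ ∑ _t : Fin a, (c + 2) + (Finset.univ : Finset (Fin a)).card := by
          gcongr with t
          exact (complexity_litPoly_le _ _).trans (by have := hw t; omega)
      _ = (c + 3) * a := by simp; ring
  calc complexity (∑ b ∈ s, ∏ t, litPoly (b t) (w t))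
      ≤ ∑ b ∈ s, complexity (∏ t, litPoly (b t) (w t)) + s.card :=
        complexity_finset_sum_le _ _
    _ ≤ ∑ _b ∈ s, (c + 3) * a + s.card := by gcongr with b hb; exact hprod b hb
    _ = s.card * ((c + 3) * a + 1) := by rw [Finset.sum_const, smul_eq_mul]; ring
    _ ≤ 2 ^ a * ((c + 3) * a + 1) := Nat.mul_le_mul_right _ hs

/-- Size of the equality polynomial. [folklore] -/
theorem complexity_eqPoly_le (u v : MvPolynomial τ k) :
    complexity (eqPoly u v) ≤ 2 * (complexity u + complexity v) + 7 := by
  unfold eqPoly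
  calc complexity (u * v + (1 - u) * (1 - v))
      ≤ complexity (u * v) + complexity ((1 - u) * (1 - v)) + 1 :=
        complexity_add_le_holds _ _
    _ ≤ (complexity u + complexity v + 1) +
        (complexity (1 - u) + complexity (1 - v) + 1) + 1 := by
        gcongr <;> exact complexity_mul_le_holds _ _
    _ ≤ (complexity u + complexity v + 1) +
        ((complexity u + 2) + (complexity v + 2) + 1) + 1 := by
        gcongr <;> exact complexity_one_sub_le _
    _ = 2 * (complexity u + complexity v) + 7 := by ring

/-- Size of a gate-consistency polynomial of a gate of fan-in `≤ 2`: at most `63`. [folklore] -/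
theorem complexity_gateCheck_le (inV : ι → τ) (gV : ℕ → τ) (j : ℕ) {g : Gate ι}
    (hg : g.arity ≤ 2) : complexity (gateCheck (k := k) inV gV j g) ≤ 63 := by
  unfold gateCheck
  have h2 : ∀ a : ℕ, a ≤ 2 → 2 ^ a * ((0 + 3) * a + 1) ≤ 28 := by
    intro a ha
    interval_cases a <;> norm_num
  have hX : complexity (X (gV j) : MvPolynomial τ k) = 0 := complexity_X_holds _
  have hw : ∀ a, complexity (wirePoly (k := k) inV gV (g.args a)) ≤ 0 := by
    intro a
    cases g.args a <;> exact (complexity_X_holds _).le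
  have hT := (complexity_tablePoly_le (k := k) g.op (fun a => wirePoly inV gV (g.args a)) hw).trans
    (h2 _ hg)
  have hE := complexity_eqPoly_le (X (gV j) : MvPolynomial τ k)
    (tablePoly (k := k) g.op fun a => wirePoly inV gV (g.args a))
  omega

/-- Size of the product of the gate-consistency polynomials of a program over `B₂`:
`≤ 64 · (number of gates)`. [folklore] -/
theorem complexity_checksPoly_le (inV : ι → τ) (gV : ℕ → τ) {gs : List (Gate ι)}
    (hB : ∀ g ∈ gs, g.arity ≤ 2) : complexity (checksPoly (k := k) inV gV gs) ≤ 64 * gs.length := by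
  unfold checksPoly
  calc _ ≤ ∑ j : Fin gs.length, complexity (gateCheck (k := k) inV gV j gs[j]) +
        (Finset.univ : Finset (Fin gs.length)).card := complexity_finset_prod_le _ _
    _ ≤ ∑ _j : Fin gs.length, 63 + (Finset.univ : Finset (Fin gs.length)).card := by
        gcongr with j
        exact complexity_gateCheck_le _ _ _ (hB (gs[j]) (by simp [Fin.getElem_fin, List.getElem_mem]))
    _ = 64 * gs.length := by simp; ring

omit [CommRing k] in
/-- `deg X_s ≤ 1` (with equality over nontrivial rings, `MvPolynomial.totalDegree_X`). [folklore] -/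
theorem mvPolynomial_totalDegree_X_le_one {R : Type*} [CommSemiring R] {σ : Type*} (s : σ) :
    (X s : MvPolynomial σ R).totalDegree ≤ 1 :=
  calc (X s : MvPolynomial σ R).totalDegree
      = (monomial (Finsupp.single s 1) (1 : R)).totalDegree := rfl
    _ ≤ (Finsupp.single s 1).sum fun _ => id := totalDegree_monomial_le _ _
    _ ≤ 1 := by simp

/-- `deg (1 - f) ≤ deg f`. [folklore] -/
theorem totalDegree_one_sub_le (f : MvPolynomial τ k) : (1 - f).totalDegree ≤ f.totalDegree := by
  refine (totalDegree_sub _ _).trans ?_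
  simp

/-- `deg lit_b(u) ≤ deg u`. [folklore] -/
theorem totalDegree_litPoly_le (b : Bool) (u : MvPolynomial τ k) :
    (litPoly b u).totalDegree ≤ u.totalDegree := by
  cases b
  · exact totalDegree_one_sub_le u
  · exact le_rfl

/-- Degree of a truth-table polynomial in arguments of degree `≤ 1`: at most the arity. [folklore] -/
theorem totalDegree_tablePoly_le {a : ℕ} (op : (Fin a → Bool) → Bool) (w : Fin a → MvPolynomial τ k)
    (hw : ∀ t, (w t).totalDegree ≤ 1) : (tablePoly op w).totalDegree ≤ a := by
  unfold tablePoly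
  refine totalDegree_finsetSum_le fun b _ => (totalDegree_finsetProd _ _).trans ?_
  calc ∑ t, (litPoly (b t) (w t)).totalDegree ≤ ∑ _t : Fin a, 1 := by
        gcongr with t
        exact (totalDegree_litPoly_le _ _).trans (hw t)
    _ = a := by simp

/-- Degree of the equality polynomial. [folklore] -/
theorem totalDegree_eqPoly_le (u v : MvPolynomial τ k) :
    (eqPoly u v).totalDegree ≤ u.totalDegree + v.totalDegree := by
  unfold eqPoly
  refine (totalDegree_add _ _).trans (max_le (totalDegree_mul _ _) ?_)
  exact (totalDegree_mul _ _).trans (add_le_add (totalDegree_one_sub_le _) (totalDegree_one_sub_le _))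

/-- Degree of a gate-consistency polynomial: at most `arity + 1`. [folklore] -/
theorem totalDegree_gateCheck_le (inV : ι → τ) (gV : ℕ → τ) (j : ℕ) (g : Gate ι) :
    (gateCheck (k := k) inV gV j g).totalDegree ≤ g.arity + 1 := by
  unfold gateCheck
  refine (totalDegree_eqPoly_le _ _).trans ?_
  rw [add_comm]
  refine add_le_add (totalDegree_tablePoly_le _ _ fun a => ?_) (mvPolynomial_totalDegree_X_le_one _)
  cases g.args a <;> exact mvPolynomial_totalDegree_X_le_one _

/-- Degree of the product of the gate-consistency polynomials of a program over `B₂`: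
`≤ 3 · (number of gates)`. [folklore] -/
theorem totalDegree_checksPoly_le (inV : ι → τ) (gV : ℕ → τ) {gs : List (Gate ι)}
    (hB : ∀ g ∈ gs, g.arity ≤ 2) : (checksPoly (k := k) inV gV gs).totalDegree ≤ 3 * gs.length := by
  unfold checksPoly
  refine (totalDegree_finsetProd _ _).trans ?_
  calc ∑ j : Fin gs.length, (gateCheck (k := k) inV gV j gs[j]).totalDegree
      ≤ ∑ _j : Fin gs.length, 3 := by
        gcongr with j
        have hj := hB (gs[j]) (by simp [Fin.getElem_fin, List.getElem_mem])
        exact (totalDegree_gateCheck_le _ _ _ _).trans (by omega)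
    _ = 3 * gs.length := by simp; ring

/-! ### Degree of Boolean sums -/

omit [CommRing k] in
/-- Substituting polynomials of degree `≤ 1` does not increase the total degree. [folklore] -/
theorem totalDegree_aeval_le_of_le_one {R : Type*} [CommSemiring R] {σ : Type*}
    (h : σ → MvPolynomial τ R) (hh : ∀ i, (h i).totalDegree ≤ 1) (g : MvPolynomial σ R) :
    (aeval h g).totalDegree ≤ g.totalDegree := by
  conv_lhs => rw [g.as_sum]
  rw [map_sum]
  refine totalDegree_finsetSum_le fun d hd => ?_
  rw [aeval_monomial, ← C_eq_algebraMap]  -- hmm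
  refine (totalDegree_mul _ _).trans ?_
  rw [totalDegree_C, zero_add, Finsupp.prod]
  refine (totalDegree_finsetProd _ _).trans ?_
  calc ∑ i ∈ d.support, (h i ^ d i).totalDegree ≤ ∑ i ∈ d.support, d i := by
        gcongr with i
        calc (h i ^ d i).totalDegree ≤ d i * (h i).totalDegree := totalDegree_pow _ _
          _ ≤ d i * 1 := Nat.mul_le_mul_left _ (hh i)
          _ = d i := mul_one _
    _ ≤ g.totalDegree := le_totalDegree hd

omit [CommRing k] in
/-- The Boolean sum does not increase the total degree (Bürgisser 2000, Rem. 2.6's setting: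
`deg ∑_e g(X, e) ≤ deg g`). [cite: Burgisser2000, Def. 2.5] -/
theorem totalDegree_boolSum_le {R : Type*} [CommSemiring R] {σ : Type*} {m : ℕ}
    (g : MvPolynomial (σ ⊕ Fin m) R) : (boolSum g).totalDegree ≤ g.totalDegree := by
  unfold boolSum
  refine totalDegree_finsetSum_le fun e _ => totalDegree_aeval_le_of_le_one _ (fun i => ?_) g
  rcases i with i | j
  · exact mvPolynomial_totalDegree_X_le_one _
  · simp only [Sum.elim_inr]
    split_ifs <;> simp

omit [CommRing k] in
/-- Evaluation of a Boolean sum: `(∑_e g(X, e))(a) = ∑_e g(a, e)`. [cite: Burgisser2000, Def. 2.5] -/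
theorem eval_boolSum {R : Type*} [CommSemiring R] {σ : Type*} {m : ℕ}
    (g : MvPolynomial (σ ⊕ Fin m) R) (pt : σ → R) :
    eval pt (boolSum g) = ∑ e : Fin m → Bool, eval (Sum.elim pt (boolPoint R e)) g := by
  unfold boolSum
  rw [map_sum]
  refine Finset.sum_congr rfl fun e _ => ?_
  have hF : (fun i => eval pt (Sum.elim X (fun j => if e j then (1 : MvPolynomial σ R) else 0) i)) =
      Sum.elim pt (boolPoint R e) := by
    funext i
    rcases i with i | j
    · simp
    · simp only [Sum.elim_inr, boolPoint_apply]
      split_ifs <;> simp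
  rw [aeval_eq_bind₁, ← hF]
  exact eval₂Hom_bind₁ _ _ _ _

end Arith

/-! ### The certificate-checking polynomials `H_{n,m}` -/

section Construction

variable {k : Type u} [CommRing k]

/-- Boolean-sum variable of certificate bit `i` (variables `Fin (U + 1)`; indices `≥ U` are
clamped to the dummy variable `U`). [folklore] -/
def certVar (U i : ℕ) : Fin (U + 1) := ⟨min i U, by omega⟩

/-- Boolean-sum variable holding the value of gate `j`: index `P + j` (clamped to `U`). [folklore] -/
def gateVar (U P j : ℕ) : Fin (U + 1) := ⟨min (P + j) U, by omega⟩

/-- Input wires of the pair circuit (`x`-bits and certificate bits) as variables of the witness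
polynomial. [folklore] -/
def inVar (n m U : ℕ) : Fin n ⊕ Fin m → Fin n ⊕ Fin (U + 1) :=
  Sum.map id fun i => certVar U i

/-- Gate wires as variables of the witness polynomial. [folklore] -/
def gVar (n U P : ℕ) (j : ℕ) : Fin n ⊕ Fin (U + 1) := Sum.inr (gateVar U P j)

/-- The Boolean-sum variables used neither by a certificate of length `m` nor by the `s` gates:
they are forced to `0`. [folklore] -/
def unusedVars (m U P s : ℕ) : Finset (Fin (U + 1)) :=
  Finset.univ.filter fun i => ¬ (i.1 < m) ∧ ¬ (P ≤ i.1 ∧ i.1 < P + s)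

/-- The polynomial `H_{n,m}(X, E)` in the input variables `X_1, …, X_n` and Boolean-sum variables
`E_0, …, E_U`: (product of the gate-consistency polynomials of the program `gs` on the pair
(`x`, certificate `E_0 … E_{m-1}`) with gate values `E_P … E_{P+s-1}`) `×` (output wire) `×`
`∏_{unused i} (1 - E_i)`. At a Boolean point it is `1` exactly on the unique consistent extension
of an accepted certificate (Bürgisser 2000 TCS, §5 (A2): `f_n = ∏_K g_K`, whose Boolean sum over
the auxiliary variables counts satisfying assignments). [cite: Burgisser2000TCS, §5 (A2) pp. 84–85] -/
def certCountPoly (n m U P : ℕ) (gs : List (Gate (Fin n ⊕ Fin m))) (out : (Fin n ⊕ Fin m) ⊕ ℕ) :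
    MvPolynomial (Fin n ⊕ Fin (U + 1)) k :=
  checksPoly (inVar n m U) (gVar n U P) gs * wirePoly (inVar n m U) (gVar n U P) out *
    ∏ i ∈ unusedVars m U P gs.length, (1 - X (Sum.inr i))

/-- The certificate read off an assignment of the Boolean-sum variables. [folklore] -/
def certOf (m U : ℕ) (e : Fin (U + 1) → Bool) : Fin m → Bool := fun i => e (certVar U i)

/-- The consistent extension of a certificate `y`: `(y, gate values of the program on (x, y),
zeros)`. [folklore] -/
def encodeRun (n m U P : ℕ) (gs : List (Gate (Fin n ⊕ Fin m))) (x : Fin n → Bool)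
    (y : Fin m → Bool) : Fin (U + 1) → Bool := fun i =>
  if h : i.1 < m then y ⟨i.1, h⟩
  else if P ≤ i.1 ∧ i.1 < P + gs.length then
    wireOf (Sum.elim x y) (vals gs (Sum.elim x y)) (.inr (i.1 - P))
  else false

variable {n m U P : ℕ} {gs : List (Gate (Fin n ⊕ Fin m))}

/-- Reading back the certificate from its consistent extension. [folklore] -/
theorem certOf_encodeRun (hm : m ≤ P) (hs : P + gs.length ≤ U) (x : Fin n → Bool)
    (y : Fin m → Bool) : certOf m U (encodeRun n m U P gs x y) = y := by
  funext i
  have hi : min (i : ℕ) U = i := min_eq_left (by omega)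
  simp only [certOf, encodeRun, certVar, hi, i.2, dif_pos]

/-- The input wires of the pair circuit read `(x, certOf e)` off the point `(x, e)`. [folklore] -/
theorem sumElim_comp_inVar (x : Fin n → Bool) (e : Fin (U + 1) → Bool) :
    Sum.elim x e ∘ inVar n m U = Sum.elim x (certOf m U e) := by
  funext i
  rcases i with i | i <;> rfl

/-- **Uniqueness of the consistent extension.** The gate equations hold at `(x, e)` and the unused
variables vanish iff `e` is the consistent extension of the certificate it contains. [folklore] -/
theorem consistent_iff (hm : m ≤ P) (hs : P + gs.length ≤ U) (x : Fin n → Bool)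
    (e : Fin (U + 1) → Bool) :
    ((∀ j, j < gs.length → Sum.elim x e (gVar n U P j) =
        wireOf (Sum.elim x (certOf m U e)) (vals gs (Sum.elim x (certOf m U e))) (.inr j)) ∧
      ∀ i ∈ unusedVars m U P gs.length, e i = false) ↔
    e = encodeRun n m U P gs x (certOf m U e) := by
  constructor
  · rintro ⟨hA, hC⟩
    funext i
    unfold encodeRun
    split_ifs with h1 h2
    · -- a certificate bit
      have hi : certVar U i = i := Fin.ext (min_eq_left (by omega))
      simp only [certOf, hi]
    · -- a gate bit
      have hj := hA (i - P) (by omega)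
      have hi : gVar n U P (i - P) = Sum.inr i := by
        simp only [gVar, gateVar, Sum.inr.injEq]
        exact Fin.ext (by simp only; omega)
      rwa [hi, Sum.elim_inr] at hj
    · -- an unused bit
      exact hC i (by simp only [unusedVars, Finset.mem_filter, Finset.mem_univ, true_and]; exact ⟨h1, h2⟩)
  · intro h
    have h' : ∀ i, e i = encodeRun n m U P gs x (certOf m U e) i := fun i => congrFun h i
    constructor
    · intro j hj
      have hv : (gateVar U P j : ℕ) = P + j := min_eq_left (by omega)
      simp only [gVar, Sum.elim_inr]
      rw [h' (gateVar U P j)]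
      unfold encodeRun
      rw [dif_neg (by omega), if_pos (by omega), hv, Nat.add_sub_cancel_left]
    · intro i hi
      simp only [unusedVars, Finset.mem_filter, Finset.mem_univ, true_and] at hi
      rw [h' i]
      unfold encodeRun
      rw [dif_neg hi.1, if_neg hi.2]

/-- The factor `∏_{unused i} (1 - E_i)` at a Boolean point: `[all unused bits are 0]`. [folklore] -/
theorem eval_prod_unused (x : Fin n → Bool) (e : Fin (U + 1) → Bool) (S : Finset (Fin (U + 1))) :
    ∏ i ∈ S, eval (boolPoint k (Sum.elim x e)) (1 - X (Sum.inr i) : MvPolynomial _ k) =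
      if ∀ i ∈ S, e i = false then 1 else 0 := by
  by_cases h : ∀ i ∈ S, e i = false
  · rw [if_pos h]
    refine Finset.prod_eq_one fun i hi => ?_
    simp [h i hi]
  · rw [if_neg h]
    push Not at h
    obtain ⟨i, hi, hei⟩ := h
    refine Finset.prod_eq_zero hi ?_
    simp only [ne_eq, Bool.not_eq_false] at hei
    simp [hei]

/-- **Evaluation of `H_{n,m}` at Boolean points**: `H_{n,m}(x, e) = 1` if `e` is the consistent
extension of its certificate `y = certOf e` and the output wire of the program on `(x, y)`
carries `1`; otherwise `H_{n,m}(x, e) = 0`. [cite: Burgisser2000TCS, §5 (A2) pp. 84–85] -/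
theorem eval_certCountPoly (hwf : WF gs) {out : (Fin n ⊕ Fin m) ⊕ ℕ}
    (hout : ∀ j, out = .inr j → j < gs.length) (hm : m ≤ P) (hs : P + gs.length ≤ U)
    (x : Fin n → Bool) (e : Fin (U + 1) → Bool) :
    eval (boolPoint k (Sum.elim x e)) (certCountPoly n m U P gs out) =
      if e = encodeRun n m U P gs x (certOf m U e) ∧
          wireOf (Sum.elim x (certOf m U e)) (vals gs (Sum.elim x (certOf m U e))) out = true
      then 1 else 0 := by
  simp only [certCountPoly, map_mul, map_prod, eval_checksPoly hwf, eval_wirePoly,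
    sumElim_comp_inVar, eval_prod_unused]
  by_cases hAC : (∀ j, j < gs.length → Sum.elim x e (gVar n U P j) =
        wireOf (Sum.elim x (certOf m U e)) (vals gs (Sum.elim x (certOf m U e))) (.inr j)) ∧
      ∀ i ∈ unusedVars m U P gs.length, e i = false
  · obtain ⟨hA, hC⟩ := hAC
    have he := (consistent_iff hm hs x e).1 ⟨hA, hC⟩
    have hB : Sum.elim (Sum.elim x (certOf m U e)) (Sum.elim x e ∘ gVar n U P) out =
        wireOf (Sum.elim x (certOf m U e)) (vals gs (Sum.elim x (certOf m U e))) out := by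
      rcases out with i | j
      · rfl
      · exact hA j (hout j rfl)
    rw [if_pos hA, if_pos hC, one_mul, mul_one, hB]
    by_cases hbit : wireOf (Sum.elim x (certOf m U e)) (vals gs (Sum.elim x (certOf m U e))) out
        = true
    · rw [hbit, bitVal_true, if_pos ⟨he, rfl⟩]
    · rw [Bool.not_eq_true] at hbit
      rw [hbit, bitVal_false, if_neg (show ¬ (_ ∧ false = true) from fun h => Bool.false_ne_true h.2)]
  · have hne : ¬ e = encodeRun n m U P gs x (certOf m U e) := fun h =>
      hAC ((consistent_iff hm hs x e).2 h)
    rw [if_neg (show ¬ (e = encodeRun n m U P gs x (certOf m U e) ∧ _) from fun h => hne h.1)]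
    rcases not_and_or.1 hAC with hA | hC
    · rw [if_neg hA]; simp
    · rw [if_neg hC]; simp

/-- **Counting by Boolean summation**: `∑_{e ∈ {0,1}^{U+1}} H_{n,m}(x, e)` is the number of
certificates `y ∈ {0,1}^m` on which the output wire of the program carries `1`
(Bürgisser 2000 TCS, §5 (A2), p. 85: "`g_n(x) = |{y | φ_n(x, y)}|`"). [cite: Burgisser2000TCS, §5 (A2) p. 85] -/
theorem sum_eval_certCountPoly (hwf : WF gs) {out : (Fin n ⊕ Fin m) ⊕ ℕ}
    (hout : ∀ j, out = .inr j → j < gs.length) (hm : m ≤ P) (hs : P + gs.length ≤ U)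
    (x : Fin n → Bool) :
    ∑ e : Fin (U + 1) → Bool, eval (boolPoint k (Sum.elim x e)) (certCountPoly n m U P gs out) =
      ((Finset.univ.filter fun y : Fin m → Bool =>
        wireOf (Sum.elim x y) (vals gs (Sum.elim x y)) out = true).card : k) := by
  simp only [eval_certCountPoly hwf hout hm hs, Finset.sum_boole]
  congr 1
  refine Finset.card_nbij' (certOf m U) (encodeRun n m U P gs x) (fun e he => ?_) (fun y hy => ?_)
    (fun e he => ?_) (fun y hy => ?_)
  · simp only [Finset.coe_filter, Finset.mem_univ, true_and, Set.mem_setOf_eq] at he ⊢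
    exact he.2
  · simp only [Finset.coe_filter, Finset.mem_univ, true_and, Set.mem_setOf_eq] at hy ⊢
    rw [certOf_encodeRun hm hs]
    exact ⟨rfl, hy⟩
  · simp only [Finset.coe_filter, Finset.mem_univ, true_and, Set.mem_setOf_eq] at he
    exact he.1.symm
  · exact certOf_encodeRun hm hs x y

/-- Size of `H_{n,m}`: linear in the number of Boolean-sum variables. [folklore] -/
theorem complexity_certCountPoly_le (hB : ∀ g ∈ gs, g.arity ≤ 2) (hs : P + gs.length ≤ U)
    (out : (Fin n ⊕ Fin m) ⊕ ℕ) :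
    complexity (certCountPoly (k := k) n m U P gs out) ≤ 67 * U + 5 := by
  unfold certCountPoly
  have h1 := complexity_checksPoly_le (k := k) (inVar n m U) (gVar n U P) hB
  have h2 : complexity (wirePoly (k := k) (inVar n m U) (gVar n U P) out) = 0 := by
    cases out <;> exact complexity_X_holds _
  have h3 : complexity (∏ i ∈ unusedVars m U P gs.length,
      (1 - X (Sum.inr i) : MvPolynomial (Fin n ⊕ Fin (U + 1)) k)) ≤ 3 * (U + 1) := by
    refine (complexity_finset_prod_le _ _).trans ?_
    have hc : (unusedVars m U P gs.length).card ≤ U + 1 :=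
      (Finset.card_filter_le _ _).trans (by simp)
    calc ∑ i ∈ unusedVars m U P gs.length, complexity (1 - X (Sum.inr i) : MvPolynomial _ k) +
          (unusedVars m U P gs.length).card
        ≤ ∑ _i ∈ unusedVars m U P gs.length, 2 + (unusedVars m U P gs.length).card := by
          gcongr with i
          exact (complexity_one_sub_le _).trans (by rw [complexity_X_holds])
      _ ≤ 3 * (U + 1) := by rw [Finset.sum_const, smul_eq_mul]; omega
  calc _ ≤ complexity (checksPoly (k := k) (inVar n m U) (gVar n U P) gs *
          wirePoly (inVar n m U) (gVar n U P) out) +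
        complexity (∏ i ∈ unusedVars m U P gs.length,
          (1 - X (Sum.inr i) : MvPolynomial (Fin n ⊕ Fin (U + 1)) k)) + 1 :=
        complexity_mul_le_holds _ _
    _ ≤ (complexity (checksPoly (k := k) (inVar n m U) (gVar n U P) gs) +
          complexity (wirePoly (k := k) (inVar n m U) (gVar n U P) out) + 1) +
        complexity (∏ i ∈ unusedVars m U P gs.length,
          (1 - X (Sum.inr i) : MvPolynomial (Fin n ⊕ Fin (U + 1)) k)) + 1 := by
        gcongr; exact complexity_mul_le_holds _ _
    _ ≤ (64 * gs.length + 0 + 1) + 3 * (U + 1) + 1 := by gcongr; exact h2.le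
    _ ≤ 67 * U + 5 := by omega

/-- Degree of `H_{n,m}`: linear in the number of Boolean-sum variables. [folklore] -/
theorem totalDegree_certCountPoly_le (hB : ∀ g ∈ gs, g.arity ≤ 2) (hs : P + gs.length ≤ U)
    (out : (Fin n ⊕ Fin m) ⊕ ℕ) :
    (certCountPoly (k := k) n m U P gs out).totalDegree ≤ 4 * U + 2 := by
  unfold certCountPoly
  have h1 := totalDegree_checksPoly_le (k := k) (inVar n m U) (gVar n U P) hB
  have h2 : (wirePoly (k := k) (inVar n m U) (gVar n U P) out).totalDegree ≤ 1 := by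
    cases out <;> exact mvPolynomial_totalDegree_X_le_one _
  have h3 : (∏ i ∈ unusedVars m U P gs.length,
      (1 - X (Sum.inr i) : MvPolynomial (Fin n ⊕ Fin (U + 1)) k)).totalDegree ≤ U + 1 := by
    refine (totalDegree_finsetProd _ _).trans ?_
    have hc : (unusedVars m U P gs.length).card ≤ U + 1 :=
      (Finset.card_filter_le _ _).trans (by simp)
    calc ∑ i ∈ unusedVars m U P gs.length, (1 - X (Sum.inr i) : MvPolynomial _ k).totalDegree
        ≤ ∑ _i ∈ unusedVars m U P gs.length, 1 := by
          gcongr with i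
          exact (totalDegree_one_sub_le _).trans (mvPolynomial_totalDegree_X_le_one _)
      _ ≤ U + 1 := by rw [Finset.sum_const, smul_eq_mul]; omega
  calc _ ≤ (checksPoly (k := k) (inVar n m U) (gVar n U P) gs *
          wirePoly (inVar n m U) (gVar n U P) out).totalDegree +
        (∏ i ∈ unusedVars m U P gs.length,
          (1 - X (Sum.inr i) : MvPolynomial (Fin n ⊕ Fin (U + 1)) k)).totalDegree :=
        totalDegree_mul _ _
    _ ≤ ((checksPoly (k := k) (inVar n m U) (gVar n U P) gs).totalDegree +
          (wirePoly (k := k) (inVar n m U) (gVar n U P) out).totalDegree) +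
        (∏ i ∈ unusedVars m U P gs.length,
          (1 - X (Sum.inr i) : MvPolynomial (Fin n ⊕ Fin (U + 1)) k)).totalDegree := by
        gcongr; exact totalDegree_mul _ _
    _ ≤ (3 * gs.length + 1) + (U + 1) := by gcongr
    _ ≤ 4 * U + 2 := by omega

end Construction

/-! ### The p-definable counting family and the discharge of (A2) -/

section Family

variable {k : Type u} [CommRing k]

/-- Monotonicity of evaluation of polynomials with natural coefficients (private copy of
`Literature.Computability.Complexity.natPoly_eval_mono` of `CircuitLowerBounds.lean`, which is not imported here). [folklore] -/
private theorem natPoly_eval_mono' (q : Polynomial ℕ) {a b : ℕ} (h : a ≤ b) : q.eval a ≤ q.eval b := by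
  rw [Polynomial.eval_eq_sum_range, Polynomial.eval_eq_sum_range]
  exact Finset.sum_le_sum fun i _ => Nat.mul_le_mul_left _ (Nat.pow_le_pow_left h i)

/-- `∑_{m < N} 2^m < 2^N`. [folklore] -/
theorem sum_two_pow_lt (N : ℕ) : ∑ m ∈ Finset.range N, 2 ^ m < 2 ^ N := by
  induction N with
  | zero => simp
  | succ N ih => rw [Finset.sum_range_succ, pow_succ]; omega

/-- The `VP` witness `g_n = ∑_{m ≤ p(n)} H_{n,m}` of the counting family, in the variables
`X_1, …, X_n` and `E_0, …, E_{U(n)}` (Bürgisser 2000 TCS, §5 (A2): the p-computable family whose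
Boolean sum is the counting function). [cite: Burgisser2000TCS, §5 (A2) pp. 84–85] -/
def witnessPoly (p U : ℕ → ℕ) (gs : ∀ n m : ℕ, List (Gate (Fin n ⊕ Fin m)))
    (out : ∀ n m : ℕ, Unit → (Fin n ⊕ Fin m) ⊕ ℕ) (n : ℕ) :
    MvPolynomial (Fin n ⊕ Fin (U n + 1)) k :=
  ∑ m ∈ Finset.range (p n + 1), certCountPoly n m (U n) (p n) (gs n m) (out n m ())

/-- The counting family `f_n = ∑_{e ∈ {0,1}^{U(n)+1}} g_n(X, e)` (Bürgisser 2000 TCS, §5 (A2):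
`g_n = ∑_e f_n(X, e)`, `g_n(x)` = number of accepting certificates). [cite: Burgisser2000TCS, §5 (A2) p. 85] -/
def countPoly (p U : ℕ → ℕ) (gs : ∀ n m : ℕ, List (Gate (Fin n ⊕ Fin m)))
    (out : ∀ n m : ℕ, Unit → (Fin n ⊕ Fin m) ⊕ ℕ) (n : ℕ) : MvPolynomial (Fin n) k :=
  boolSum (witnessPoly p U gs out n)

/-- The number of certificates `y`, `|y| ≤ p(n)`, with `⟨x, y⟩ ∈ L'` (the `#P` function of the
verifier `L'`; Bürgisser 2000 TCS, p. 75 and §5 (A2)). [cite: Burgisser2000TCS, §2 p. 75] -/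
def certCount (p : ℕ → ℕ) (L' : Language Bool) (n : ℕ) (x : Fin n → Bool) : ℕ :=
  ∑ m ∈ Finset.range (p n + 1),
    (Finset.univ.filter fun y : Fin m → Bool => boolPair (List.ofFn x) (List.ofFn y) ∈ L').card

/-- `certCount p L' n x < 2 ^ (p n + 1)`. [folklore] -/
theorem certCount_lt (p : ℕ → ℕ) (L' : Language Bool) (n : ℕ) (x : Fin n → Bool) :
    certCount p L' n x < 2 ^ (p n + 1) := by
  refine lt_of_le_of_lt (Finset.sum_le_sum fun m _ => ?_) (sum_two_pow_lt (p n + 1))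
  exact (Finset.card_filter_le _ _).trans (by simp)

/-- Membership in the `NP` language is positivity of the certificate count. [cite: Burgisser2000TCS, §2 p. 75] -/
theorem mem_iff_certCount_pos {L L' : Language Bool} {p : Polynomial ℕ}
    (hp : ∀ x : List Bool, x ∈ L ↔ ∃ y : List Bool, y.length ≤ p.eval x.length ∧ boolPair x y ∈ L')
    (n : ℕ) (x : Fin n → Bool) :
    List.ofFn x ∈ L ↔ 0 < certCount (fun n => p.eval n) L' n x := by
  rw [hp, List.length_ofFn, certCount]
  constructor
  · rintro ⟨y, hy, hmem⟩
    refine lt_of_lt_of_le ?_ (Finset.single_le_sum (fun m _ => Nat.zero_le _)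
      (Finset.mem_range.2 (Nat.lt_succ_of_le hy)))
    refine Finset.card_pos.2 ⟨y.get, ?_⟩
    simpa using hmem
  · intro hpos
    obtain ⟨m, hm, hcard⟩ : ∃ m ∈ Finset.range (p.eval n + 1), (Finset.univ.filter
        fun y : Fin m → Bool => boolPair (List.ofFn x) (List.ofFn y) ∈ L').card ≠ 0 := by
      by_contra h
      push Not at h
      exact hpos.ne' (Finset.sum_eq_zero h)
    obtain ⟨y, hy⟩ := Finset.card_pos.1 (Nat.pos_of_ne_zero hcard)
    simp only [Finset.mem_filter, Finset.mem_univ, true_and] at hy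
    exact ⟨List.ofFn y, by simpa [Nat.lt_succ_iff] using hm, hy⟩

omit [CommRing k] in
/-- `boolPoint` of a concatenated bit vector. [folklore] -/
theorem boolPoint_sumElim {R : Type*} [Zero R] [One R] {α β : Type*} (x : α → Bool) (e : β → Bool) :
    boolPoint R (Sum.elim x e) = Sum.elim (boolPoint R x) (boolPoint R e) := by
  funext i
  rcases i with i | i <;> rfl

variable {L' : Language Bool} {p U : ℕ → ℕ} {gs : ∀ n m : ℕ, List (Gate (Fin n ⊕ Fin m))}
  {out : ∀ n m : ℕ, Unit → (Fin n ⊕ Fin m) ⊕ ℕ}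

/-- **The counting identity** `f_n(x) = #{y : |y| ≤ p(n), ⟨x, y⟩ ∈ L'}` on Boolean points, for
programs `gs n m` realizing the verifier on pairs (Bürgisser 2000 TCS, §5 (A2), p. 85). [cite: Burgisser2000TCS, §5 (A2) p. 85] -/
theorem eval_countPoly
    (hR : ∀ n m, Realizes B2 (gs n m) (out n m) fun (w : Fin n ⊕ Fin m → Bool) (_ : Unit) =>
      L'.boolIndicator (boolPair (List.ofFn fun i => w (.inl i)) (List.ofFn fun j => w (.inr j))))
    (hs : ∀ n m, m ≤ p n → p n + (gs n m).length ≤ U n) (n : ℕ) (x : Fin n → Bool) :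
    eval (boolPoint k x) (countPoly p U gs out n) = (certCount p L' n x : k) := by
  rw [countPoly, eval_boolSum]
  simp only [← boolPoint_sumElim, witnessPoly, map_sum]
  rw [Finset.sum_comm, certCount, Nat.cast_sum]
  refine Finset.sum_congr rfl fun m hm => ?_
  have hm' : m ≤ p n := Nat.lt_succ_iff.1 (Finset.mem_range.1 hm)
  rw [sum_eval_certCountPoly (hR n m).wf (fun j hj => (hR n m).outOK () j hj) hm' (hs n m hm')]
  congr 2
  ext y
  simp only [Finset.mem_filter, Finset.mem_univ, true_and, (hR n m).eval, Sum.elim_inl,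
    Sum.elim_inr]
  rw [← Set.mem_iff_boolIndicator]
  rfl

/-- Size of the `VP` witness: `L(g_n) ≤ (p(n) + 1)(67 U(n) + 6)`. [folklore] -/
theorem complexity_witnessPoly_le (hB : ∀ n m, ∀ g ∈ gs n m, g.arity ≤ 2)
    (hs : ∀ n m, m ≤ p n → p n + (gs n m).length ≤ U n) (n : ℕ) :
    complexity (witnessPoly (k := k) p U gs out n) ≤ (p n + 1) * (67 * U n + 6) := by
  unfold witnessPoly
  refine (complexity_finset_sum_le _ _).trans ?_
  rw [Finset.card_range]
  calc ∑ m ∈ Finset.range (p n + 1),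
        complexity (certCountPoly (k := k) n m (U n) (p n) (gs n m) (out n m ())) + (p n + 1)
      ≤ ∑ _m ∈ Finset.range (p n + 1), (67 * U n + 5) + (p n + 1) := by
        gcongr with m hm
        exact complexity_certCountPoly_le (hB n m)
          (hs n m (Nat.lt_succ_iff.1 (Finset.mem_range.1 hm))) _
    _ = (p n + 1) * (67 * U n + 6) := by rw [Finset.sum_const, Finset.card_range, smul_eq_mul]; ring

/-- Degree of the `VP` witness: `deg g_n ≤ 4 U(n) + 2`. [folklore] -/
theorem totalDegree_witnessPoly_le (hB : ∀ n m, ∀ g ∈ gs n m, g.arity ≤ 2)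
    (hs : ∀ n m, m ≤ p n → p n + (gs n m).length ≤ U n) (n : ℕ) :
    (witnessPoly (k := k) p U gs out n).totalDegree ≤ 4 * U n + 2 := by
  unfold witnessPoly
  exact totalDegree_finsetSum_le fun m hm => totalDegree_certCountPoly_le (hB n m)
    (hs n m (Nat.lt_succ_iff.1 (Finset.mem_range.1 hm))) _

/-- The `VP` witness is a p-computable p-family when `p` and `U` are p-bounded
(Bürgisser 2000 TCS, §5 (A2): "the family `(f_n)` is p-computable"). [cite: Burgisser2000TCS, §5 (A2) p. 84] -/
theorem isVPFamily_witnessPoly (hB : ∀ n m, ∀ g ∈ gs n m, g.arity ≤ 2)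
    (hs : ∀ n m, m ≤ p n → p n + (gs n m).length ≤ U n) (hp : IsPBounded p) (hU : IsPBounded U) :
    IsVPFamily (witnessPoly (k := k) p U gs out) := by
  refine ⟨⟨?_, ?_⟩, ?_⟩
  · refine (IsPBounded.add_holds IsPBounded.id (IsPBounded.add_holds hU (IsPBounded.const 1))).mono
      fun n => ?_
    simp
  · exact (IsPBounded.add_holds (IsPBounded.mul_holds (IsPBounded.const 4) hU)
      (IsPBounded.const 2)).mono fun n => totalDegree_witnessPoly_le hB hs n
  · exact (IsPBounded.mul_holds (IsPBounded.add_holds hp (IsPBounded.const 1))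
      (IsPBounded.add_holds (IsPBounded.mul_holds (IsPBounded.const 67) hU)
        (IsPBounded.const 6))).mono fun n => complexity_witnessPoly_le hB hs n

/-- The counting family is p-definable (Bürgisser 2000 TCS, §5 (A2): "the family `(g_n)` is
p-definable"). [cite: Burgisser2000TCS, §5 (A2) p. 85] -/
theorem isVNPFamily_countPoly (hB : ∀ n m, ∀ g ∈ gs n m, g.arity ≤ 2)
    (hs : ∀ n m, m ≤ p n → p n + (gs n m).length ≤ U n) (hp : IsPBounded p) (hU : IsPBounded U) :
    IsVNPFamily (countPoly (k := k) p U gs out) := by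
  refine ⟨⟨⟨1, fun n => by simp⟩, ?_⟩, fun n => U n + 1, witnessPoly p U gs out,
    isVPFamily_witnessPoly hB hs hp hU, fun n => rfl⟩
  exact (IsPBounded.add_holds (IsPBounded.mul_holds (IsPBounded.const 4) hU)
    (IsPBounded.const 2)).mono fun n =>
      (totalDegree_boolSum_le _).trans (totalDegree_witnessPoly_le hB hs n)

end Family

/-- **Discharge of (A2)** `NP_booleanPart_VNP k` (Bürgisser 2000 TCS, §5 (A2), pp. 84–85,
`#P ⊆ BP(VNP_k)`, composed with `NP = {{x | φ(x) ≥ 1} | φ ∈ #P}`, p. 75): for `L ∈ NP` with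
verifier `L' ∈ P` and certificate bound `p`, the verifier on pairs `⟨x, y⟩`, `|x| = n`, `|y| = m`,
has `B₂`-programs of polynomial size (`P ⊆ P/poly`, `P_subset_PPoly_holds`, and
`exists_cktSize_boolPair_of_mem_PPoly`); arithmetising their gates (`certCountPoly`) gives a
p-computable family whose Boolean sum `countPoly` takes the value
`#{y : |y| ≤ p(n), ⟨x, y⟩ ∈ L'}` at `x ∈ {0,1}ⁿ` (`eval_countPoly`), a number `< 2^{p(n)+1}` which is
positive iff `x ∈ L`. The printed proof arithmetises the clauses of Cook's 3-CNF instead of the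
gates directly; each gate-consistency polynomial is the arithmetisation of the `≤ 8` clauses of one
gate. [cite: Burgisser2000TCS, §5 (A2) pp. 84–85 and Thm. 1.1(1) p. 73] -/
theorem NP_booleanPart_VNP_holds (k : Type u) [Field k] : NP_booleanPart_VNP k := by
  intro L hL
  obtain ⟨L', hL'P, p, hp⟩ := hL
  obtain ⟨q, hq⟩ := exists_cktSize_boolPair_of_mem_PPoly (P_subset_PPoly_holds hL'P)
  simp only [CktSize] at hq
  choose gs out hlen hR using hq
  -- the certificate bound, the number of Boolean-sum variables
  set pf : ℕ → ℕ := fun n => p.eval n with hpf_def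
  set U : ℕ → ℕ := fun n => pf n + ((2 * n + 2 + pf n) + q.eval (2 * n + 2 + pf n)) with hU_def
  have hpf : IsPBounded pf := (isPBounded_iff_exists_polynomial_holds pf).2 ⟨p, fun n => le_rfl⟩
  have hU : IsPBounded U := by
    refine (isPBounded_iff_exists_polynomial_holds U).2
      ⟨p + ((2 * Polynomial.X + 2 + p) + q.comp (2 * Polynomial.X + 2 + p)), fun n => le_of_eq ?_⟩
    simp [hU_def, hpf_def]
  have hs : ∀ n m, m ≤ pf n → pf n + (gs n m).length ≤ U n := by
    intro n m hm
    have h1 := hlen n m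
    have h2 : q.eval (2 * n + 2 + m) ≤ q.eval (2 * n + 2 + pf n) := natPoly_eval_mono' q (by omega)
    simp only [hU_def]
    omega
  have hB : ∀ n m, ∀ g ∈ gs n m, g.arity ≤ 2 := fun n m g hg => (hR n m).isOver g hg
  refine ⟨countPoly pf U gs out, certCount pf L', fun n => pf n + 1,
    isVNPFamily_countPoly hB hs hpf hU, ⟨?_, fun n x => certCount_lt pf L' n x, fun n x => ?_⟩,
    fun n x => mem_iff_certCount_pos hp n x⟩
  · exact IsPBounded.add_holds hpf (IsPBounded.const 1)
  · exact eval_countPoly hR hs n x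

/-! ## Part III: the target fact with (A2) discharged -/

section Discharged

variable {k : Type u} [Field k]

/-- `NP ⊆ P/poly` from `VP_k = VNP_k`, GRH, characteristic zero and the named fact (A3) alone
((A2) being proved; Bürgisser 2000 TCS, p. 79). [cite: Burgisser2000TCS, Cor. 1.2(1) p. 74 and its proof p. 79] -/
theorem NP_subset_PPoly_of_VP_eq_VNP_of_A3 (hA3 : booleanPart_VP_cktSize k) [CharZero k]
    (hGRH : Literature.NumberTheory.LFunctions.ExtendedRiemannHypothesis) (h : VP k = VNP k) : NP ⊆ PPoly :=
  NP_subset_PPoly_of_VP_eq_VNP (NP_booleanPart_VNP_holds k) hA3 hGRH h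

/-- **The target fact from (A3) and Thm. 6.18**: `PPoly_eq_polyAdvice_NP_of_VP_eq_VNP k`
(Bürgisser 2000 TCS, Cor. 1.2(1); book Cor. 4.6(1)) follows from the named facts
`booleanPart_VP_cktSize k` (TCS Thm. 1.1(1), where GRH and Thm. 4.1 live) and
`PPoly_eq_polyAdvice_P` (Arora–Barak 2009, Thm. 6.18), the inclusion `#P ⊆ BP(VNP_k)` being
proved above. [cite: Burgisser2000TCS, Cor. 1.2(1) p. 74] [cite: Burgisser2000, Cor. 4.6(1)] -/
theorem PPoly_eq_polyAdvice_NP_of_VP_eq_VNP_of_A3 (h618 : PPoly_eq_polyAdvice_P)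
    (hA3 : booleanPart_VP_cktSize k) : PPoly_eq_polyAdvice_NP_of_VP_eq_VNP k :=
  PPoly_eq_polyAdvice_NP_of_VP_eq_VNP_of_facts h618 (NP_booleanPart_VNP_holds k) hA3

/-- Likewise the first conjunct `polyAdvice P = polyAdvice NP` of
`burgisser_collapse_of_VP_eq_VNP_charZero k` from (A3) and Thm. 6.18 (Bürgisser 2000 TCS,
Cor. 1.2(1)). [cite: Burgisser2000TCS, Cor. 1.2(1) p. 74] -/
theorem polyAdvice_P_eq_polyAdvice_NP_of_VP_eq_VNP_of_A3 (h618 : PPoly_eq_polyAdvice_P)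
    (hA3 : booleanPart_VP_cktSize k) [CharZero k] (hGRH : Literature.NumberTheory.LFunctions.ExtendedRiemannHypothesis)
    (h : VP k = VNP k) : polyAdvice P = polyAdvice NP :=
  polyAdvice_P_eq_polyAdvice_NP_of_VP_eq_VNP_of_facts h618 (NP_booleanPart_VNP_holds k) hA3 hGRH h

end Discharged

end Literature.Computability.AlgebraicComplexity
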